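import Summits.AtomisticToContinuum.Crystallization.Theorems.OverbindingBudgetAffineCompressedCutCore

/-!
# OverbindingBudget · AffineCompressedCut — rider «Hop» (lens-4 g82, head start on (iii) = the 79K energy inequality, part III)

Cell `decomp-a2c`, seat lens-4, generation 82.  ELEMENTARY·PROVED, no new numeric hypothesis, no new `Prop` definitions.

COVERING BY WINDOWED SITES AND THE HOP.  «Core» (part II) windows the scale `nn_k ∈ [9/10, 26/25]·nn_i` on the `5.475·nn_i`-core of an affinely
deep site `i`; the radius is capped near `(12 − 1)/2` by the containment geometry of descent chains (a chain toward a target at distance `d` is only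
known to stay within `d` of the target, i.e. within `2d` of its base).  The far annuli `[5.475, 10.5]·nn_i` of the tail («Tail», part I) are reached by
HOPPING: descend from `i` toward a POINT `p₁` of the segment `[y i, y k]`, arrive at a site `j₁` with `dist (y j₁) p₁ < nn_{j₁}` (the configuration has
no hole of radius `nn` inside the charted region), and descend again from `j₁` — toward the next segment point or toward `y k` itself, where the descent
ARRIVES (`…Chains.eq_of_dist_lt_nearestDist`).  Each hop only needs charts within `dist (base, target)` of the target, so the excursion from `y i`
is `|target − y i| + (hop length)`, not twice the total distance.

* ★ `approach_point` — GENERIC: base `b` (`0 < nn_b`), target point `p` with `dist (y b) p ≤ a·nn_b`, chart clauses + injective registration +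
  affine framing at every site `j` with `dist (y j) p ≤ dist (y b) p`, and `a < L·(9967/10⁴)^L/5` ⟹ some site `j` has `dist (y j) p < nn_j`,
  `nn_j ∈ [(9967/10⁴)^L, (1.0011)^L]·nn_b`, `dist (y j) p ≤ dist (y b) p`.  Proof: iterate `…Chains.descent_step_near` (gain `nn/5` per registered
  step while `nn ≤ dist`), carrying the scale window by `…Scale.affFramed_scale_transfer_record` / `nearestDist_le_of_dist_le` and the distinctness of
  a registered step (`…Core.registered_step`); after `L` steps the budget `L·(9967/10⁴)^L·nn_b/5 > dist (y b) p` is exhausted, so the walk arrived.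
* `approach_site` — target `p = y k` a site: the arriving site IS `k`, so `nn_k` is windowed.
* ★ `hop` / `hop_site` — the same in `nn_i`-UNITS for a base `b` already windowed (`nn_b ∈ [lo, hi]·nn_i`) inside the charted `R·nn_i`-ball of `i`:
  `dist (y b) p ≤ nn_b + e·nn_i`, containment `(hi + e)·nn_i + dist p (y i) ≤ R·nn_i`, budget `1 + e/lo < L·(9967/10⁴)^L/5` ⟹ arrival site `j`
  with `nn_j ∈ [(9967/10⁴)^L·lo, (1.0011)^L·hi]·nn_i` (resp. the window for the target site `k`).
* `segment_point`, `dist_segment_points` — the points `x + (s/dist x z)•(z − x)` of a segment and their distances.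

Consumer: rider «Far» (part IV: the tiers `[27/5, 8]`, `[8, 47/5]`, `[47/5, 101/10]`, `[101/10, 21/2]` (units `nn_i`) with floors `83/100, 79/100, 77/100,
3/4` under `AffDeepReg 12 (1/10^4) (1/1000) (1/450) y i`), then «Sum» (g83).
-/

namespace Summit.AtomisticToContinuum.Crystallization.Theorems.OverbindingBudgetAffineCompressedCutHop

open Literature.Geometry.DiscreteGeometry (nearestDist nearestDist_nonneg nearestDist_le_dist fccTwoShellPattern hcpTwoShellPattern)
open Summit.AtomisticToContinuum.Crystallization.Theorems.OverbindingBudgetAffineLadder (AffFramed)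
open Summit.AtomisticToContinuum.Crystallization.Theorems.OverbindingBudgetAffineCompressedCutChains (eq_of_dist_lt_nearestDist descent_step_near)
open Summit.AtomisticToContinuum.Crystallization.Theorems.OverbindingBudgetAffineCompressedCutScale (affFramed_scale_transfer_record
  nearestDist_le_of_dist_le)
open Summit.AtomisticToContinuum.Crystallization.Theorems.OverbindingBudgetAffineCompressedCutCore (registered_step)

variable {N : ℕ}

/-! ## §1  Approaching a point along registered first-shell steps -/

/-- ★ **APPROACH A POINT.**  See the module docstring: the walk from `b` toward `p` arrives at a site `j` with `dist (y j) p < nn_j`, whose scale is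
windowed relative to `nn_b`, never leaving the ball of radius `dist (y b) p` about `p`. [this file] -/
theorem approach_point {y : Fin N → EuclideanSpace ℝ (Fin 3)} (hy : Function.Injective y) {b : Fin N} (hν : 0 < nearestDist y b)
    {A : Fin N → (EuclideanSpace ℝ (Fin 3) →ₗ[ℝ] EuclideanSpace ℝ (Fin 3))} {Q : Fin N → (EuclideanSpace ℝ (Fin 3) →ₗᵢ[ℝ] EuclideanSpace ℝ (Fin 3))}
    {P : Fin N → Finset (EuclideanSpace ℝ (Fin 3))} {f : Fin N → EuclideanSpace ℝ (Fin 3) → EuclideanSpace ℝ (Fin 3)}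
    (p : EuclideanSpace ℝ (Fin 3)) {a : ℝ} {L : ℕ}
    (hP : ∀ j, dist (y j) p ≤ dist (y b) p → P j = fccTwoShellPattern ∨ P j = hcpTwoShellPattern)
    (hA : ∀ j, dist (y j) p ≤ dist (y b) p → ∀ v ∈ P j, ‖A j v - Q j v‖ ≤ 1 / 1000)
    (hf : ∀ j, dist (y j) p ≤ dist (y b) p →
      ∀ v ∈ P j, f j v ∈ Set.range y ∧ dist (f j v) (y j + nearestDist y j • A j v) ≤ 1 / 10 ^ 4 * nearestDist y j)
    (hinj : ∀ j, dist (y j) p ≤ dist (y b) p → Set.InjOn (f j) ↑(P j))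
    (hfr : ∀ j, dist (y j) p ≤ dist (y b) p → AffFramed (1 / 10 ^ 4) (1 / 1000) (1 / 450) y j)
    (hap : dist (y b) p ≤ a * nearestDist y b) (hL : a < L * (1 / 5) * (9967 / 10000) ^ L) :
    ∃ j, dist (y j) p < nearestDist y j ∧ (9967 / 10000) ^ L * nearestDist y b ≤ nearestDist y j ∧
      nearestDist y j ≤ (10011 / 10000) ^ L * nearestDist y b ∧ dist (y j) p ≤ dist (y b) p := by
  -- induction on the step budget `n`: either arrived, or `n` gains of `(1/5)·(9967/10⁴)^L·nn_b` banked
  have ind : ∀ n ≤ L, ∃ j, dist (y j) p ≤ dist (y b) p ∧ (9967 / 10000) ^ n * nearestDist y b ≤ nearestDist y j ∧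
      nearestDist y j ≤ (10011 / 10000) ^ n * nearestDist y b ∧
      (dist (y j) p < nearestDist y j ∨ dist (y j) p ≤ dist (y b) p - n * (1 / 5 * ((9967 / 10000) ^ L * nearestDist y b))) := by
    intro n
    induction n with
    | zero =>
      intro _
      refine ⟨b, le_rfl, by rw [pow_zero, one_mul], by rw [pow_zero, one_mul], Or.inr ?_⟩
      rw [Nat.cast_zero, zero_mul, sub_zero]
    | succ n ih =>
      intro hn
      obtain ⟨j, hjp, hlo, hup, halt⟩ := ih (by omega)
      have hlmono : ((9967 / 10000 : ℝ)) ^ (n + 1) * nearestDist y b ≤ (9967 / 10000) ^ n * nearestDist y b :=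
        mul_le_mul_of_nonneg_right (pow_le_pow_of_le_one (by norm_num) (by norm_num) (by omega)) hν.le
      have humono : ((10011 / 10000 : ℝ)) ^ n * nearestDist y b ≤ (10011 / 10000) ^ (n + 1) * nearestDist y b :=
        mul_le_mul_of_nonneg_right (pow_le_pow_right₀ (by norm_num) (by omega)) hν.le
      by_cases harr : dist (y j) p < nearestDist y j
      · exact ⟨j, hjp, hlmono.trans hlo, hup.trans humono, Or.inl harr⟩
      have hprog : dist (y j) p ≤ dist (y b) p - n * (1 / 5 * ((9967 / 10000) ^ L * nearestDist y b)) := by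
        rcases halt with h | h
        · exact absurd h harr
        · exact h
      push Not at harr
      obtain ⟨v, hv, hv1, ⟨k, hk⟩, hgain⟩ := descent_step_near (hP j hjp) (hA j hjp) (hf j hjp) p harr
      obtain ⟨hne, hd⟩ := registered_step hy (hP j hjp) (hA j hjp) (hf j hjp) (hinj j hjp) hv hv1 hk
      have hkp' : dist (y k) p ≤ dist (y j) p - 1 / 5 * nearestDist y j := by rw [hk]; exact hgain
      have hkp : dist (y k) p ≤ dist (y b) p := by linarith [nearestDist_nonneg y j]
      have hlo' := affFramed_scale_transfer_record hy (hfr j hjp) (hfr k hkp) hne hd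
      have hup' := nearestDist_le_of_dist_le hne hd
      have hμ : (1 + 1 / 1000 + 1 / 10 ^ 4 : ℝ) = 10011 / 10000 := by norm_num
      rw [hμ] at hup'
      have hLn : ((9967 / 10000 : ℝ)) ^ L * nearestDist y b ≤ nearestDist y j :=
        le_trans (mul_le_mul_of_nonneg_right (pow_le_pow_of_le_one (by norm_num) (by norm_num) (by omega : n ≤ L)) hν.le) hlo
      refine ⟨k, hkp, ?_, ?_, Or.inr ?_⟩
      · calc ((9967 / 10000 : ℝ)) ^ (n + 1) * nearestDist y b = 9967 / 10000 * ((9967 / 10000) ^ n * nearestDist y b) := by ring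
          _ ≤ 9967 / 10000 * nearestDist y j := mul_le_mul_of_nonneg_left hlo (by norm_num)
          _ ≤ nearestDist y k := hlo'
      · calc nearestDist y k ≤ 10011 / 10000 * nearestDist y j := hup'
          _ ≤ 10011 / 10000 * ((10011 / 10000) ^ n * nearestDist y b) := mul_le_mul_of_nonneg_left hup (by norm_num)
          _ = (10011 / 10000) ^ (n + 1) * nearestDist y b := by ring
      · have e : ((n + 1 : ℕ) : ℝ) * (1 / 5 * ((9967 / 10000) ^ L * nearestDist y b)) =
            n * (1 / 5 * ((9967 / 10000) ^ L * nearestDist y b)) + 1 / 5 * ((9967 / 10000) ^ L * nearestDist y b) := by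
          push_cast; ring
        rw [e]
        linarith
  obtain ⟨j, hjp, hlo, hup, halt⟩ := ind L le_rfl
  rcases halt with harr | hprog
  · exact ⟨j, harr, hlo, hup, hjp⟩
  · exfalso
    have h1 : a * nearestDist y b < L * (1 / 5) * (9967 / 10000) ^ L * nearestDist y b := mul_lt_mul_of_pos_right hL hν
    have h2 : (L : ℝ) * (1 / 5) * (9967 / 10000) ^ L * nearestDist y b = L * (1 / 5 * ((9967 / 10000) ^ L * nearestDist y b)) := by ring
    have h3 : 0 ≤ dist (y j) p := dist_nonneg
    linarith

/-- **APPROACH A SITE**: toward a target SITE `k` the walk arrives AT `k` (a site within `nn_j` of `y j` is `j`), so `nn_k` is windowed relative to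
`nn_b`. [this file] -/
theorem approach_site {y : Fin N → EuclideanSpace ℝ (Fin 3)} (hy : Function.Injective y) {b : Fin N} (hν : 0 < nearestDist y b)
    {A : Fin N → (EuclideanSpace ℝ (Fin 3) →ₗ[ℝ] EuclideanSpace ℝ (Fin 3))} {Q : Fin N → (EuclideanSpace ℝ (Fin 3) →ₗᵢ[ℝ] EuclideanSpace ℝ (Fin 3))}
    {P : Fin N → Finset (EuclideanSpace ℝ (Fin 3))} {f : Fin N → EuclideanSpace ℝ (Fin 3) → EuclideanSpace ℝ (Fin 3)}
    (k : Fin N) {a : ℝ} {L : ℕ}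
    (hP : ∀ j, dist (y j) (y k) ≤ dist (y b) (y k) → P j = fccTwoShellPattern ∨ P j = hcpTwoShellPattern)
    (hA : ∀ j, dist (y j) (y k) ≤ dist (y b) (y k) → ∀ v ∈ P j, ‖A j v - Q j v‖ ≤ 1 / 1000)
    (hf : ∀ j, dist (y j) (y k) ≤ dist (y b) (y k) →
      ∀ v ∈ P j, f j v ∈ Set.range y ∧ dist (f j v) (y j + nearestDist y j • A j v) ≤ 1 / 10 ^ 4 * nearestDist y j)
    (hinj : ∀ j, dist (y j) (y k) ≤ dist (y b) (y k) → Set.InjOn (f j) ↑(P j))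
    (hfr : ∀ j, dist (y j) (y k) ≤ dist (y b) (y k) → AffFramed (1 / 10 ^ 4) (1 / 1000) (1 / 450) y j)
    (hak : dist (y b) (y k) ≤ a * nearestDist y b) (hL : a < L * (1 / 5) * (9967 / 10000) ^ L) :
    (9967 / 10000) ^ L * nearestDist y b ≤ nearestDist y k ∧ nearestDist y k ≤ (10011 / 10000) ^ L * nearestDist y b := by
  obtain ⟨j, hj, hlo, hup, -⟩ := approach_point hy hν (y k) hP hA hf hinj hfr hak hL
  have hjk : j = k := eq_of_dist_lt_nearestDist hj
  subst hjk
  exact ⟨hlo, hup⟩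

/-! ## §2  The hop in `nn_i`-units inside a charted ball -/

/-- ★ **HOP (point target).**  Inside the charted `R·nn_i`-ball of `i`, from a base `b` with `nn_b ∈ [lo, hi]·nn_i` (`0 < lo`) toward a point `p` with
`dist (y b) p ≤ nn_b + e·nn_i` (`0 ≤ e`): if `(hi + e)·nn_i + dist p (y i) ≤ R·nn_i` (containment) and `1 + e/lo < L·(9967/10⁴)^L/5` (budget), some site
`j` has `dist (y j) p < nn_j`, `nn_j ∈ [(9967/10⁴)^L·lo, (1.0011)^L·hi]·nn_i` and `dist (y j) p ≤ nn_b + e·nn_i`. [this file] -/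
theorem hop {y : Fin N → EuclideanSpace ℝ (Fin 3)} (hy : Function.Injective y) {i b : Fin N} (hν : 0 < nearestDist y i)
    {A : Fin N → (EuclideanSpace ℝ (Fin 3) →ₗ[ℝ] EuclideanSpace ℝ (Fin 3))} {Q : Fin N → (EuclideanSpace ℝ (Fin 3) →ₗᵢ[ℝ] EuclideanSpace ℝ (Fin 3))}
    {P : Fin N → Finset (EuclideanSpace ℝ (Fin 3))} {f : Fin N → EuclideanSpace ℝ (Fin 3) → EuclideanSpace ℝ (Fin 3)} {R : ℝ}
    (hP : ∀ j, dist (y j) (y i) ≤ R * nearestDist y i → P j = fccTwoShellPattern ∨ P j = hcpTwoShellPattern)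
    (hA : ∀ j, dist (y j) (y i) ≤ R * nearestDist y i → ∀ v ∈ P j, ‖A j v - Q j v‖ ≤ 1 / 1000)
    (hf : ∀ j, dist (y j) (y i) ≤ R * nearestDist y i →
      ∀ v ∈ P j, f j v ∈ Set.range y ∧ dist (f j v) (y j + nearestDist y j • A j v) ≤ 1 / 10 ^ 4 * nearestDist y j)
    (hinj : ∀ j, dist (y j) (y i) ≤ R * nearestDist y i → Set.InjOn (f j) ↑(P j))
    (hfr : ∀ j, dist (y j) (y i) ≤ R * nearestDist y i → AffFramed (1 / 10 ^ 4) (1 / 1000) (1 / 450) y j)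
    (p : EuclideanSpace ℝ (Fin 3)) {lo hi e : ℝ} {L : ℕ} (hlo0 : 0 < lo) (hlo : lo * nearestDist y i ≤ nearestDist y b)
    (hhi : nearestDist y b ≤ hi * nearestDist y i) (he : 0 ≤ e) (hbp : dist (y b) p ≤ nearestDist y b + e * nearestDist y i)
    (hcont : (hi + e) * nearestDist y i + dist p (y i) ≤ R * nearestDist y i) (hL : 1 + e / lo < L * (1 / 5) * (9967 / 10000) ^ L) :
    ∃ j, dist (y j) p < nearestDist y j ∧ (9967 / 10000) ^ L * lo * nearestDist y i ≤ nearestDist y j ∧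
      nearestDist y j ≤ (10011 / 10000) ^ L * hi * nearestDist y i ∧ dist (y j) p ≤ nearestDist y b + e * nearestDist y i := by
  have hνb : 0 < nearestDist y b := lt_of_lt_of_le (mul_pos hlo0 hν) hlo
  -- the target is within `(1 + e/lo)·nn_b`
  have hap : dist (y b) p ≤ (1 + e / lo) * nearestDist y b := by
    have h1 : e * nearestDist y i ≤ e / lo * nearestDist y b := by
      have h2 : e / lo * (lo * nearestDist y i) ≤ e / lo * nearestDist y b := mul_le_mul_of_nonneg_left hlo (div_nonneg he hlo0.le)
      have h3 : e / lo * (lo * nearestDist y i) = e * nearestDist y i := by field_simp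
      linarith
    calc dist (y b) p ≤ nearestDist y b + e * nearestDist y i := hbp
      _ ≤ nearestDist y b + e / lo * nearestDist y b := by linarith
      _ = (1 + e / lo) * nearestDist y b := by ring
  -- the region `dist (y j) p ≤ dist (y b) p` lies in the charted ball
  have hreg : ∀ j, dist (y j) p ≤ dist (y b) p → dist (y j) (y i) ≤ R * nearestDist y i := by
    intro j hj
    have h1 : dist (y j) (y i) ≤ dist (y j) p + dist p (y i) := dist_triangle _ _ _
    have h2 : nearestDist y b + e * nearestDist y i ≤ (hi + e) * nearestDist y i := by nlinarith
    linarith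
  obtain ⟨j, hj, hlo', hup', hjp⟩ := approach_point hy hνb p (fun j hj => hP j (hreg j hj)) (fun j hj => hA j (hreg j hj))
    (fun j hj => hf j (hreg j hj)) (fun j hj => hinj j (hreg j hj)) (fun j hj => hfr j (hreg j hj)) hap hL
  refine ⟨j, hj, ?_, ?_, hjp.trans hbp⟩
  · calc ((9967 / 10000 : ℝ)) ^ L * lo * nearestDist y i = (9967 / 10000) ^ L * (lo * nearestDist y i) := by ring
      _ ≤ (9967 / 10000) ^ L * nearestDist y b := mul_le_mul_of_nonneg_left hlo (by positivity)
      _ ≤ nearestDist y j := hlo'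
  · calc nearestDist y j ≤ (10011 / 10000) ^ L * nearestDist y b := hup'
      _ ≤ (10011 / 10000) ^ L * (hi * nearestDist y i) := mul_le_mul_of_nonneg_left hhi (by positivity)
      _ = (10011 / 10000) ^ L * hi * nearestDist y i := by ring

/-- ★ **HOP (site target).**  As `hop`, toward a SITE `k`: the walk arrives at `k`, so `nn_k ∈ [(9967/10⁴)^L·lo, (1.0011)^L·hi]·nn_i`. [this file] -/
theorem hop_site {y : Fin N → EuclideanSpace ℝ (Fin 3)} (hy : Function.Injective y) {i b : Fin N} (hν : 0 < nearestDist y i)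
    {A : Fin N → (EuclideanSpace ℝ (Fin 3) →ₗ[ℝ] EuclideanSpace ℝ (Fin 3))} {Q : Fin N → (EuclideanSpace ℝ (Fin 3) →ₗᵢ[ℝ] EuclideanSpace ℝ (Fin 3))}
    {P : Fin N → Finset (EuclideanSpace ℝ (Fin 3))} {f : Fin N → EuclideanSpace ℝ (Fin 3) → EuclideanSpace ℝ (Fin 3)} {R : ℝ}
    (hP : ∀ j, dist (y j) (y i) ≤ R * nearestDist y i → P j = fccTwoShellPattern ∨ P j = hcpTwoShellPattern)
    (hA : ∀ j, dist (y j) (y i) ≤ R * nearestDist y i → ∀ v ∈ P j, ‖A j v - Q j v‖ ≤ 1 / 1000)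
    (hf : ∀ j, dist (y j) (y i) ≤ R * nearestDist y i →
      ∀ v ∈ P j, f j v ∈ Set.range y ∧ dist (f j v) (y j + nearestDist y j • A j v) ≤ 1 / 10 ^ 4 * nearestDist y j)
    (hinj : ∀ j, dist (y j) (y i) ≤ R * nearestDist y i → Set.InjOn (f j) ↑(P j))
    (hfr : ∀ j, dist (y j) (y i) ≤ R * nearestDist y i → AffFramed (1 / 10 ^ 4) (1 / 1000) (1 / 450) y j)
    (k : Fin N) {lo hi e : ℝ} {L : ℕ} (hlo0 : 0 < lo) (hlo : lo * nearestDist y i ≤ nearestDist y b)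
    (hhi : nearestDist y b ≤ hi * nearestDist y i) (he : 0 ≤ e) (hbk : dist (y b) (y k) ≤ nearestDist y b + e * nearestDist y i)
    (hcont : (hi + e) * nearestDist y i + dist (y k) (y i) ≤ R * nearestDist y i) (hL : 1 + e / lo < L * (1 / 5) * (9967 / 10000) ^ L) :
    (9967 / 10000) ^ L * lo * nearestDist y i ≤ nearestDist y k ∧ nearestDist y k ≤ (10011 / 10000) ^ L * hi * nearestDist y i := by
  obtain ⟨j, hj, hlo', hup', -⟩ := hop hy hν hP hA hf hinj hfr (y k) hlo0 hlo hhi he hbk hcont hL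
  have hjk : j = k := eq_of_dist_lt_nearestDist hj
  subst hjk
  exact ⟨hlo', hup'⟩

/-! ## §3  Segment points -/

/-- The point `p` at arc length `s` on the segment from `x` to `z` (`0 ≤ s ≤ dist x z`, `x ≠ z`): distances `s` from `x` and `dist x z − s` from `z`.
(The point is passed with its defining equation, so that it stays atomic in the consumer's context.) [this file] -/
theorem segment_point {x z p : EuclideanSpace ℝ (Fin 3)} (hd : 0 < dist x z) {s : ℝ} (h0 : 0 ≤ s) (hs : s ≤ dist x z)
    (hp : p = x + (s / dist x z) • (z - x)) : dist x p = s ∧ dist p z = dist x z - s := by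
  subst hp
  have hd0 : dist x z ≠ 0 := hd.ne'
  constructor
  · rw [dist_comm, dist_eq_norm, add_sub_cancel_left, norm_smul, Real.norm_of_nonneg (div_nonneg h0 dist_nonneg), ← dist_eq_norm,
      dist_comm z x, div_mul_cancel₀ s hd0]
  · have e : x + (s / dist x z) • (z - x) - z = (1 - s / dist x z) • (x - z) := by
      rw [sub_smul, one_smul, smul_sub, smul_sub]; abel
    have h1 : 0 ≤ 1 - s / dist x z := by rw [sub_nonneg, div_le_one hd]; exact hs
    rw [dist_eq_norm, e, norm_smul, Real.norm_of_nonneg h1, ← dist_eq_norm, sub_mul, one_mul, div_mul_cancel₀ s hd0]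

/-- Two points of the same segment at arc lengths `s, s'` are `|s − s'|` apart. [this file] -/
theorem dist_segment_points {x z p p' : EuclideanSpace ℝ (Fin 3)} (hd : 0 < dist x z) {s s' : ℝ} (hp : p = x + (s / dist x z) • (z - x))
    (hp' : p' = x + (s' / dist x z) • (z - x)) : dist p p' = |s - s'| := by
  subst hp hp'
  have hd0 : dist x z ≠ 0 := hd.ne'
  have e : x + (s / dist x z) • (z - x) - (x + (s' / dist x z) • (z - x)) = ((s - s') / dist x z) • (z - x) := by
    rw [sub_div, sub_smul]; abel
  rw [dist_eq_norm, e, norm_smul, Real.norm_eq_abs, abs_div, abs_of_pos hd, ← dist_eq_norm, dist_comm z x, div_mul_cancel₀ _ hd0]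

end Summit.AtomisticToContinuum.Crystallization.Theorems.OverbindingBudgetAffineCompressedCutHop
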